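/-
COR-CM (cell pub-hodgecm2, stage 2 of the Hodge ladder) — count-neutral KERNEL COMBINATORICS «the abelian datum, dictionary: imaginary quadratic subfields»
(seat prover-pub-hodgecm2-b23-g39-0, binder prover b23, gen 39; claim ABELIAN-DATUM D6, HOME/INBOX.md).  Theorems only (Galois correspondence
over Mathlib + D1); no geometry, no named fact, nothing asserted; `Interfaces.lean` (C1), every E term, B01 and `Transposition/*` are untouched.
HONEST FRAMING (COORDINATOR RULING — HODGE FRAMING CORRECTION, 2026-08-21T11:55:35Z): `HC_CM` is NOT proved, here or anywhere in the
tree; this file is field theory and produces no period.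
T5: n/a-class — no HC-level conclusion; checker: self (prover-pub-hodgecm2-b23-g39-0), 2026-08-22.
-/
import Summits.HodgeConjecture.CorCM.FaceAbelianDatum
import Mathlib.FieldTheory.Galois.Basic
import Mathlib.GroupTheory.IndexNormal
import HarnessLib

/-!
# The abelian datum, dictionary: complex conjugation is a non-square iff the field has an imaginary quadratic subfield

D1 (`CorCM/FaceAbelianDatum.lean`) showed that the `Aut`-datum of the slice transports exists iff the conjugation automorphism `c` is NOT A
SQUARE in a commutative `Aut(F)`.  This file identifies that group-theoretic hypothesis with the classical field-theoretic one, so that the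
lane's theorems read «`F` an abelian CM field containing an imaginary quadratic field `E` (`F = E·F⁺`)»:

* §1 `not_isSquare_of_not_mem_of_index_two`: an element outside a subgroup of index two is not a square (`g·g ∈ H` always).
* §2 **`not_isSquare_of_quadratic_subfield_moved`** (any Galois number field `F`): if `F` has a subfield `E` of degree `2` over `ℚ` and an
  automorphism `c` moves some element of `E`, then `c` is not a square in `Aut(F)` (the fixing subgroup of `E` has index `2` and misses `c`);
  read at a complex embedding `σ₀` with `σ₀ ∘ c = conj ∘ σ₀`: **`not_isSquare_conjAut_of_imaginary_quadratic_subfield`** — an `E` of degree `2`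
  containing an element with non-real image under `σ₀` (an IMAGINARY quadratic subfield) makes `c` a non-square — no commutativity needed.
* §3 Conversely, for COMMUTATIVE `Aut(F)`: **`exists_imaginary_quadratic_subfield_of_not_isSquare`** — if the conjugation automorphism is
  not a square, the fixed field of the kernel of D1's detecting character is a quadratic subfield moved by `c`, i.e. with a non-real element
  under `σ₀`.  Together (`not_isSquare_conjAut_iff_exists_imaginary_quadratic_subfield`): for a Galois number field with commutative `Aut`,
  **`c ∉ Aut(F)²` iff `F` contains an imaginary quadratic field** — the hypothesis of `CorCM/FaceAbelianSlices.lean` /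
  `CorCM/FaceAbelianExact.lean` in its textbook form.

References: [cite: Washington1997, Thm. 2.5]; [cite: Shimura1998, §8.1 (p. 62)].
-/

noncomputable section

open NumberField NumberField.ComplexEmbedding

namespace Summit.HodgeConjecture.CorCM.FaceAbelian

/-! ## §1 Index two -/

/-- **An element outside a subgroup of index two is not a square** (`g·g ∈ H` for every `g`). [folklore] -/
theorem not_isSquare_of_not_mem_of_index_two {G : Type*} [Group G] {H : Subgroup G} (h2 : H.index = 2) {c : G} (hc : c ∉ H) :
    ¬ IsSquare c := by
  rintro ⟨r, hr⟩
  exact hc (hr ▸ Subgroup.mul_self_mem_of_index_two h2 r)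

/-! ## §2 A quadratic subfield moved by `c` makes `c` a non-square -/

section Field

variable {F : Type} [Field F] [NumberField F]

/-- **The fixing subgroup of a quadratic subfield has index two** (`F/ℚ` Galois). [folklore] -/
theorem index_fixingSubgroup_eq_two [IsGalois ℚ F] (E : IntermediateField ℚ F) (hE : Module.finrank ℚ E = 2) :
    E.fixingSubgroup.index = 2 := by
  have h1 : E.fixingSubgroup.index * Nat.card E.fixingSubgroup = Nat.card (F ≃ₐ[ℚ] F) := E.fixingSubgroup.index_mul_card
  rw [IsGalois.card_fixingSubgroup_eq_finrank E, IsGalois.card_aut_eq_finrank, ← Module.finrank_mul_finrank ℚ E F, hE] at h1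
  have hpos : 0 < Module.finrank (↥E) F := Module.finrank_pos
  exact Nat.eq_of_mul_eq_mul_right hpos h1

/-- **A quadratic subfield moved by `c` ⟹ `c` is not a square in `Aut(F)`** (`F/ℚ` Galois; no commutativity needed). [folklore] -/
theorem not_isSquare_of_quadratic_subfield_moved [IsGalois ℚ F] (E : IntermediateField ℚ F) (hE : Module.finrank ℚ E = 2)
    {c : F ≃ₐ[ℚ] F} (hx : ∃ x ∈ E, c x ≠ x) : ¬ IsSquare c := by
  refine not_isSquare_of_not_mem_of_index_two (index_fixingSubgroup_eq_two E hE) fun hc => ?_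
  obtain ⟨x, hxE, hx⟩ := hx
  exact hx ((IntermediateField.mem_fixingSubgroup_iff E c).mp hc x hxE)

/-- **An IMAGINARY quadratic subfield makes complex conjugation a non-square**: `c` the automorphism inducing complex conjugation at `σ₀`,
`E ⊆ F` of degree `2` with an element of non-real image under `σ₀` ⟹ `¬ IsSquare c`. [cite: Shimura1998, §8.1 (p. 62)] -/
theorem not_isSquare_conjAut_of_imaginary_quadratic_subfield [IsGalois ℚ F] (σ₀ : F →+* ℂ) {c : F ≃ₐ[ℚ] F}
    (hcσ : σ₀.comp (c : F →+* F) = conjugate σ₀) (E : IntermediateField ℚ F) (hE : Module.finrank ℚ E = 2)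
    (hx : ∃ x ∈ E, (σ₀ x).im ≠ 0) : ¬ IsSquare c := by
  refine not_isSquare_of_quadratic_subfield_moved E hE ?_
  obtain ⟨x, hxE, hx⟩ := hx
  refine ⟨x, hxE, fun hcx => hx ?_⟩
  have h1 : σ₀ (c x) = starRingEnd ℂ (σ₀ x) := by
    have := RingHom.congr_fun hcσ x
    simpa [conjugate_coe_eq] using this
  rw [hcx] at h1
  -- `σ₀ x` is fixed by conjugation, hence real
  have h2 := congrArg Complex.im h1
  rw [Complex.conj_im] at h2
  linarith

/-! ## §3 Conversely: commutative `Aut(F)` and non-square conjugation give an imaginary quadratic subfield -/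

/-- **A detecting character gives a quadratic subfield moved by `c`**: for `χ : Additive Aut(F) →+ ℤ/2` with `χ c = 1`, the fixed field of
`ker χ` has degree `2` over `ℚ` and `c` moves some of its elements (`F/ℚ` Galois). [folklore] -/
theorem exists_quadratic_subfield_moved_of_addChar [IsGalois ℚ F] {c : F ≃ₐ[ℚ] F} (χ : Additive (F ≃ₐ[ℚ] F) →+ ZMod 2)
    (hχ : χ (Additive.ofMul c) = 1) :
    ∃ E : IntermediateField ℚ F, Module.finrank ℚ E = 2 ∧ ∃ x ∈ E, c x ≠ x := by
  classical
  -- the kernel as a subgroup of index two missing `c`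
  let χ' : (F ≃ₐ[ℚ] F) →* Multiplicative (ZMod 2) :=
    { toFun := fun g => Multiplicative.ofAdd (χ (Additive.ofMul g))
      map_one' := by rw [ofMul_one, map_zero]; rfl
      map_mul' := fun g h => by rw [ofMul_mul, map_add, ofAdd_add] }
  have hχ'c : χ' c ≠ 1 := by
    show Multiplicative.ofAdd (χ (Additive.ofMul c)) ≠ 1
    rw [hχ]; decide
  have hsurj : Function.Surjective χ' := by
    intro u
    have h01 : ∀ u : Multiplicative (ZMod 2), u = 1 ∨ u = Multiplicative.ofAdd 1 := by decide
    rcases h01 u with rfl | rfl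
    · exact ⟨1, map_one χ'⟩
    · exact ⟨c, by show Multiplicative.ofAdd (χ (Additive.ofMul c)) = _; rw [hχ]⟩
  have hidx : χ'.ker.index = 2 := by
    rw [Subgroup.index_ker, MonoidHom.range_eq_top.mpr hsurj, Subgroup.card_top]
    simp
  have hcK : c ∉ χ'.ker := fun h => hχ'c (MonoidHom.mem_ker.mp h)
  refine ⟨IntermediateField.fixedField χ'.ker, ?_, ?_⟩
  · -- degree: `[F : fixedField H] = |H|` and `index · |H| = |Aut F| = [F : ℚ]`
    have h1 := IntermediateField.finrank_fixedField_eq_card χ'.ker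
    have h2 : χ'.ker.index * Nat.card χ'.ker = Nat.card (F ≃ₐ[ℚ] F) := χ'.ker.index_mul_card
    rw [hidx, IsGalois.card_aut_eq_finrank, ← Module.finrank_mul_finrank ℚ (IntermediateField.fixedField χ'.ker) F, h1] at h2
    have hpos : 0 < Nat.card χ'.ker := Nat.card_pos
    exact (Nat.eq_of_mul_eq_mul_right hpos h2).symm
  · by_contra h
    apply hcK
    rw [← IntermediateField.fixingSubgroup_fixedField χ'.ker]
    refine (IntermediateField.mem_fixingSubgroup_iff _ c).mpr fun x hx => ?_
    by_contra hne
    exact h ⟨x, hx, hne⟩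

/-- **Commutative `Aut(F)`, non-square `c` ⟹ a quadratic subfield moved by `c`** (D1 `exists_addChar_of_not_isSquare`). [folklore] -/
theorem exists_quadratic_subfield_moved_of_not_isSquare [IsGalois ℚ F] (hcomm : ∀ g h : F ≃ₐ[ℚ] F, g * h = h * g)
    {c : F ≃ₐ[ℚ] F} (hns : ¬ IsSquare c) :
    ∃ E : IntermediateField ℚ F, Module.finrank ℚ E = 2 ∧ ∃ x ∈ E, c x ≠ x := by
  letI : CommGroup (F ≃ₐ[ℚ] F) := { (inferInstance : Group (F ≃ₐ[ℚ] F)) with mul_comm := hcomm }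
  obtain ⟨χ, hχ⟩ := exists_addChar_of_not_isSquare (G := F ≃ₐ[ℚ] F) hns
  exact exists_quadratic_subfield_moved_of_addChar χ hχ

/-- **Commutative `Aut(F)`, non-square conjugation ⟹ an IMAGINARY quadratic subfield**: a subfield of degree `2` over `ℚ` with an element of
non-real image under `σ₀`. [cite: Shimura1998, §8.1 (p. 62)] -/
theorem exists_imaginary_quadratic_subfield_of_not_isSquare [IsGalois ℚ F] (hcomm : ∀ g h : F ≃ₐ[ℚ] F, g * h = h * g)
    (σ₀ : F →+* ℂ) {c : F ≃ₐ[ℚ] F} (hcσ : σ₀.comp (c : F →+* F) = conjugate σ₀) (hns : ¬ IsSquare c) :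
    ∃ E : IntermediateField ℚ F, Module.finrank ℚ E = 2 ∧ ∃ x ∈ E, (σ₀ x).im ≠ 0 := by
  obtain ⟨E, hE, x, hxE, hx⟩ := exists_quadratic_subfield_moved_of_not_isSquare hcomm hns
  refine ⟨E, hE, x, hxE, fun him => hx ?_⟩
  apply σ₀.injective
  have h1 : σ₀ (c x) = starRingEnd ℂ (σ₀ x) := by
    have := RingHom.congr_fun hcσ x
    simpa [conjugate_coe_eq] using this
  rw [h1]
  exact Complex.conj_eq_iff_im.mpr him

/-- **THE DICTIONARY.**  For a Galois number field with commutative `Aut(F)` and `c` the automorphism inducing complex conjugation at `σ₀`: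
`c` is a non-square in `Aut(F)` iff `F` contains an imaginary quadratic field (a subfield of degree `2` with a non-real element under `σ₀`).
[cite: Shimura1998, §8.1 (p. 62)] -/
theorem not_isSquare_conjAut_iff_exists_imaginary_quadratic_subfield [IsGalois ℚ F] (hcomm : ∀ g h : F ≃ₐ[ℚ] F, g * h = h * g)
    (σ₀ : F →+* ℂ) {c : F ≃ₐ[ℚ] F} (hcσ : σ₀.comp (c : F →+* F) = conjugate σ₀) :
    ¬ IsSquare c ↔ ∃ E : IntermediateField ℚ F, Module.finrank ℚ E = 2 ∧ ∃ x ∈ E, (σ₀ x).im ≠ 0 :=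
  ⟨exists_imaginary_quadratic_subfield_of_not_isSquare hcomm σ₀ hcσ,
    fun ⟨E, hE, hx⟩ => not_isSquare_conjAut_of_imaginary_quadratic_subfield σ₀ hcσ E hE hx⟩

end Field

end Summit.HodgeConjecture.CorCM.FaceAbelian

end
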